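import Literature.AlgebraicGeometry.GroupSchemes.CartierDualAnnihilatorFlat
import Literature.AlgebraicGeometry.GroupSchemes.CanonicalLineAssembly
import Literature.RingTheory.Flat.HopfIdealClosureGenericFibre
import HarnessLib

/-!
# A flat closed subgroup scheme is determined by its generic fibre (scheme dress of EGA IV₂ 2.8.5 uniqueness); annihilators commute with flat closure

Layer `Literature/AlgebraicGeometry/GroupSchemes`, namespace `Literature.AlgebraicGeometry.GroupSchemes.AffineGroupScheme` (continues ★ `RingTheory/Flat/IdealClosureGenericFibre` ∕
`HopfIdealClosureGenericFibre` — EGA IV₂ 2.8.5 in IDEAL currency: `eq_comap_includeRight_of_flat_of_map_eq` —, ★ `CanonicalLineAssembly` (B-p08 (g31)) —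
`CanonicalLine.comap_algBaseChangeEquiv_map_includeRight_ker_eq`: the ideal of a base-changed closed subscheme is the extension of the ideal —, ★
`CartierDualAnnihilatorBaseChange` p846227 — `annihilatorBaseChangeIso` — and ★ `CartierDualAnnihilatorFlat` p846454 — `free_alg_annihilator` —).  THEOREMS
ONLY (no definition, no instance, no notation, no named fact, no `sorry`).  Cell `hodgecm-mathlib` (D-0151), programme P6 «MOD», organ (CL⊥) of B-p04 (g38):
HEART-FROB §B l. 59 «dually on `𝒢^D[ϖ̄]`: `D = C^⊥` reduces to `C₀^⊥` or `C_et^⊥` (annihilators commute with closure)».  Count-neutral Mathlib-side capital: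
HC_CM is proved only modulo the printed citations until rung 0 closes; nothing here bears on it.

THE PRINT ([EGAIV2] Prop. 2.8.5: over an integral base with generic point `η`, a closed subscheme of the generic fibre `X_η` has a UNIQUE flat closed
extension to `X` — its schematic closure; two flat closed subschemes with the same generic fibre coincide; [Tate1997FiniteFlatGroupSchemes] (3.7):
applied to finite flat subgroup schemes and, through the exactness of `G ↦ G^D`, to annihilators).  HERE, for `R` a domain with fraction field `K`
and AFFINE `R`-schemes (the global-section ideal `ker Γ(c) ⊂ Γ(X)` is the currency — the HEART's Hopf-ideal currency):

* §1 **`ker_comap_eq_of_flat_of_ker_comap_pullback_map_eq`** — two closed immersions `cᵢ : Zᵢ ↪ X` of affine `R`-(group) schemes with `Γ(Zᵢ)` FLAT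
  over `R` and THE SAME GENERIC IDEAL `ker Γ((c₁)_K) = ker Γ((c₂)_K) ⊂ Γ(X_K)` have the same ideal `ker Γ(c₁) = ker Γ(c₂) ⊂ Γ(X)` (★ B-p08: `ker Γ(c_K)` is
  the extension of `ker Γ(c)`; ★ G2c: a flat ideal is the closure of its extension).
* §2 THE GENERIC IDEAL OF THE ANNIHILATOR (any `R → R′`): **`ker_comap_pullback_map_annihilatorι`** — `ker Γ((ι_{H^⊥})_{R′}) ⊂ Γ((G^D)_{R′})` is the
  pull-back along `Γ(φ_G⁻¹)` (`φ_G : (G^D)_{R′} ≅ (G_{R′})^D`, ★ `cartierDualBaseChangeIso`) of `ker Γ(ι_{(H_{R′})^⊥}) ⊂ Γ((G_{R′})^D)` — the ideal form of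
  ★ `annihilatorBaseChangeIso`.
* §3 HEAD **«ANNIHILATORS COMMUTE WITH FLAT CLOSURE»**: for `j : H ↪ G` a closed immersion of finite free commutative group schemes over a domain `R`
  (`H` = the flat closure of its generic fibre `H_K`) and ANY flat closed subgroup `c : Z ↪ G^D` whose generic ideal is that of `(ι_{H^⊥})_K` — i.e. of
  `(H_K)^⊥` up to `φ_G` (§2) —, `ker Γ(c) = ker Γ(ι_{H^⊥})`: `Z = H^⊥` as closed subschemes of `G^D`
  (`ker_comap_eq_ker_comap_annihilatorι_of_flat`, with `Γ(H^⊥)` flat as hypothesis; over a LOCAL domain — a valuation ring `𝒪_Ω` — the hypothesis is ★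
  `free_alg_annihilator`: `ker_comap_eq_ker_comap_annihilatorι_of_isLocalRing`).

## References
* [EGAIV2] A. Grothendieck, J. Dieudonné, *ÉGA* IV₂, Publ. Math. IHÉS 24 (1965), Prop. 2.8.5.
* [Tate1997FiniteFlatGroupSchemes] J. Tate, *Finite flat group schemes* (1997), (3.7), §(3.8) p. 146.
* [GortzWedhorn2020] U. Görtz, T. Wedhorn, *Algebraic Geometry I* (2nd ed.), Prop. 14.14.
-/

set_option autoImplicit false

-- Mathlib's `Over`/`Scheme` APIs are stated across semireducible wrappers (as in the ★ `GroupSchemes/*` files).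
set_option backward.isDefEq.respectTransparency false

universe u

open CategoryTheory CategoryTheory.Limits AlgebraicGeometry MonoidalCategory CartesianMonoidalCategory TensorProduct WithConv
open Algebra.TensorProduct (includeRight)

noncomputable section

namespace Literature.AlgebraicGeometry.GroupSchemes

namespace AffineGroupScheme

open scoped MonObj CategoryTheory.Obj

open Literature.AlgebraicGeometry.Motives Literature.NumberTheory.DiophantineGeometry Literature.RingTheory.HopfAlgebra Literature.RingTheory.Flat
  GroupSchemeKernel

/-! ## §1 Flat closed subschemes with the same generic ideal coincide -/

section Uniqueness

variable {R : Type u} [CommRing R] (K : Type u) [Field K] [Algebra R K] [IsFractionRing R K]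
  {X Z₁ Z₂ : SchemeOver R} [GrpObj X] [GrpObj Z₁] [GrpObj Z₂] [IsAffine X.left] [IsAffine Z₁.left] [IsAffine Z₂.left]
  (c₁ : Z₁ ⟶ X) (c₂ : Z₂ ⟶ X) [IsClosedImmersion c₁.left] [IsClosedImmersion c₂.left]

omit [GrpObj X] [GrpObj Z₁] [IsAffine Z₁.left] in
/-- `Γ(X) ⧸ ker Γ(c) ≅ Γ(Z)` for a closed immersion `c : Z ↪ X` of affine schemes (`Γ(c)` is surjective, ★ `UnitComponentIdeal.surjective_comap`), so the quotient is
`R`-flat when `Γ(Z)` is. [cite: EGAIV2, Prop. 2.8.5] -/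
theorem flat_quotient_ker_comap [Module.Flat R (Alg Z₁)] : Module.Flat R (Alg X ⧸ (RingHom.ker (Alg.comap c₁).toRingHom : Ideal (Alg X))) :=
  Module.Flat.of_linearEquiv
    (Ideal.quotientKerAlgEquivOfSurjective (UnitComponentIdeal.surjective_comap X Z₁ c₁) : (Alg X ⧸ RingHom.ker (Alg.comap c₁)) ≃ₐ[R] Alg Z₁).toLinearEquiv

/-- **FLAT CLOSED SUBSCHEMES ARE DETERMINED BY THEIR GENERIC FIBRE** (EGA IV₂ 2.8.5, uniqueness, scheme dress): two closed immersions `c₁ : Z₁ ↪ X`, `c₂ : Z₂ ↪ X`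
of affine `R`-(group) schemes with `Γ(Z₁)`, `Γ(Z₂)` FLAT over `R`, whose base changes to the field of fractions `K` (`[IsFractionRing R K]`) cut out the SAME ideal of
`Γ(X_K)`, cut out the same ideal of `Γ(X)`.  (The ideal of `(Zᵢ)_K` read in `K ⊗ Γ(X)` is the extension of `ker Γ(cᵢ)` — ★ `CanonicalLine.comap_algBaseChangeEquiv_map_includeRight_ker_eq` —
and a flat ideal is the closure of its extension — ★ `eq_comap_includeRight_of_flat_of_map_eq`.)  The group structures are not used; they are carried
because the ★ bridge is stated for group schemes. [cite: EGAIV2, Prop. 2.8.5] [cite: GortzWedhorn2020, Prop. 14.14] -/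
theorem ker_comap_eq_of_flat_of_ker_comap_pullback_map_eq [Module.Flat R (Alg Z₁)] [Module.Flat R (Alg Z₂)]
    (h : RingHom.ker (Alg.comap ((Over.pullback (Spec.map (CommRingCat.ofHom (algebraMap R K)))).map c₁)).toRingHom =
      RingHom.ker (Alg.comap ((Over.pullback (Spec.map (CommRingCat.ofHom (algebraMap R K)))).map c₂)).toRingHom) :
    (RingHom.ker (Alg.comap c₁).toRingHom : Ideal (Alg X)) = RingHom.ker (Alg.comap c₂).toRingHom := by
  haveI := isAffine_pullback_obj_left K X
  haveI := isAffine_pullback_obj_left K Z₁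
  haveI := isAffine_pullback_obj_left K Z₂
  haveI := flat_quotient_ker_comap c₁
  haveI := flat_quotient_ker_comap c₂
  -- the two extensions to `K ⊗ Γ(X)` agree (read through the algebra isomorphism `Γ(X_K) ≅ K ⊗ Γ(X)`)
  have hext : (RingHom.ker (Alg.comap c₁).toRingHom : Ideal (Alg X)).map (includeRight : Alg X →ₐ[R] K ⊗[R] Alg X) =
      (RingHom.ker (Alg.comap c₂).toRingHom : Ideal (Alg X)).map (includeRight : Alg X →ₐ[R] K ⊗[R] Alg X) := by
    apply Ideal.comap_injective_of_surjective (algBaseChangeEquiv K X) (algBaseChangeEquiv K X).surjective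
    rw [CanonicalLine.comap_algBaseChangeEquiv_map_includeRight_ker_eq K X Z₁ c₁, CanonicalLine.comap_algBaseChangeEquiv_map_includeRight_ker_eq K X Z₂ c₂, h]
  rw [eq_comap_includeRight_of_flat_of_map_eq (R := R) (K := K) _ (RingHom.ker (Alg.comap c₁).toRingHom : Ideal (Alg X)) rfl,
    eq_comap_includeRight_of_flat_of_map_eq (R := R) (K := K) _ (RingHom.ker (Alg.comap c₂).toRingHom : Ideal (Alg X)) rfl, hext]

end Uniqueness

/-! ## §2 The generic ideal of the annihilator -/

section AnnihilatorIdeal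

variable {R : Type u} [CommRing R] (R' : Type u) [CommRing R'] [Algebra R R'] {H G : SchemeOver R}
  [GrpObj H] [IsCommMonObj H] [IsAffine H.left] [Module.Free R (Alg H)] [Module.Finite R (Alg H)]
  [GrpObj G] [IsCommMonObj G] [IsAffine G.left] [Module.Free R (Alg G)] [Module.Finite R (Alg G)]
  (j : H ⟶ G) [IsMonHom j]

omit [IsCommMonObj H] [Module.Free R (Alg H)] [Module.Finite R (Alg H)] [IsCommMonObj G] [Module.Free R (Alg G)] [Module.Finite R (Alg G)] [IsMonHom j]
  [GrpObj H] [GrpObj G] [IsAffine H.left] in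
/-- `ker Γ(e ≫ x) = ker Γ(x)` for an isomorphism `e` (`Γ(e)` is injective); `ker Γ(x ≫ e′) = Γ(e′)⁻¹(ker Γ(x))`. [cite: GortzWedhorn2020, Prop. 14.14] -/
theorem ker_comap_iso_hom_comp {X Y Z : SchemeOver R} (e : X ≅ Y) (x : Y ⟶ Z) :
    RingHom.ker (Alg.comap (e.hom ≫ x)).toRingHom = RingHom.ker (Alg.comap x).toRingHom := by
  ext a
  rw [RingHom.mem_ker, RingHom.mem_ker, Alg.comap_comp]
  change Alg.comap e.hom (Alg.comap x a) = 0 ↔ Alg.comap x a = 0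
  constructor
  · intro ha
    have h2 := congrArg (Alg.comap e.inv) ha
    rwa [← AlgHom.comp_apply, ← Alg.comap_comp, e.inv_hom_id, Alg.comap_id, AlgHom.id_apply, map_zero] at h2
  · intro ha
    rw [ha, map_zero]

/-- **THE GENERIC IDEAL OF `H^⊥`** (ideal form of ★ `annihilatorBaseChangeIso`): for any `R → R′`, the ideal `ker Γ((ι_{H^⊥})_{R′})` of `(H^⊥)_{R′} ⊂ (G^D)_{R′}` is the
pull-back along `Γ(φ_G⁻¹) : Γ((G^D)_{R′}) → Γ((G_{R′})^D)` of the ideal `ker Γ(ι_{(H_{R′})^⊥})` of `(H_{R′})^⊥ ⊂ (G_{R′})^D` — since `e⁻¹ ≫ (ι_{H^⊥})_{R′} = ι_{(H_{R′})^⊥} ≫ φ_G⁻¹`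
(★ `annihilatorBaseChangeIso_inv_comp_pullback_map_annihilatorι`).  The instance hypotheses on the base changes are those of ★ `CartierDualAnnihilatorBaseChange`
(discharge with ★ `isAffine_pullback_obj_left`, ★ `free_∕finite_alg_baseChange`). [cite: Tate1997FiniteFlatGroupSchemes, §(3.8) p. 146] -/
theorem ker_comap_pullback_map_annihilatorι
    [IsAffine ((Over.pullback (Spec.map (CommRingCat.ofHom (algebraMap R R')))).obj H).left]
    [Module.Free R' (Alg ((Over.pullback (Spec.map (CommRingCat.ofHom (algebraMap R R')))).obj H))]
    [Module.Finite R' (Alg ((Over.pullback (Spec.map (CommRingCat.ofHom (algebraMap R R')))).obj H))]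
    [IsAffine ((Over.pullback (Spec.map (CommRingCat.ofHom (algebraMap R R')))).obj (cartierDual H)).left]
    [IsAffine ((Over.pullback (Spec.map (CommRingCat.ofHom (algebraMap R R')))).obj G).left]
    [Module.Free R' (Alg ((Over.pullback (Spec.map (CommRingCat.ofHom (algebraMap R R')))).obj G))]
    [Module.Finite R' (Alg ((Over.pullback (Spec.map (CommRingCat.ofHom (algebraMap R R')))).obj G))]
    [IsAffine ((Over.pullback (Spec.map (CommRingCat.ofHom (algebraMap R R')))).obj (cartierDual G)).left] :
    RingHom.ker (Alg.comap ((Over.pullback (Spec.map (CommRingCat.ofHom (algebraMap R R')))).map (annihilatorι j))).toRingHom =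
      (RingHom.ker (Alg.comap (annihilatorι ((Over.pullback (Spec.map (CommRingCat.ofHom (algebraMap R R')))).map j))).toRingHom).comap
        (Alg.comap (cartierDualBaseChangeIso R' G).inv).toRingHom := by
  rw [← ker_comap_iso_hom_comp (annihilatorBaseChangeIso R' j).symm, Iso.symm_hom, annihilatorBaseChangeIso_inv_comp_pullback_map_annihilatorι,
    Alg.comap_comp]
  ext a
  rw [RingHom.mem_ker, Ideal.mem_comap, RingHom.mem_ker]
  rfl

end AnnihilatorIdeal

/-! ## §3 HEAD: annihilators commute with flat closure -/

section Head

variable {R : Type u} [CommRing R] (K : Type u) [Field K] [Algebra R K] [IsFractionRing R K] {H G Z : SchemeOver R}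
  [GrpObj H] [IsCommMonObj H] [IsAffine H.left] [Module.Free R (Alg H)] [Module.Finite R (Alg H)]
  [GrpObj G] [IsCommMonObj G] [IsAffine G.left] [Module.Free R (Alg G)] [Module.Finite R (Alg G)]
  (j : H ⟶ G) [IsMonHom j] [IsClosedImmersion j.left]
  [GrpObj Z] [IsAffine Z.left] (c : Z ⟶ cartierDual G) [IsClosedImmersion c.left] [Module.Flat R (Alg Z)]

omit [IsClosedImmersion j.left] in
/-- **ANNIHILATORS COMMUTE WITH FLAT CLOSURE** (flatness of `Γ(H^⊥)` as a hypothesis — automatic over a local domain, next): if a FLAT closed subgroup `c : Z ↪ G^D`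
and `H^⊥` cut out the same ideal of `Γ((G^D)_K)` generically (§2 reads that of `H^⊥` off `(H_K)^⊥`), then `Z = H^⊥` as closed subschemes of `G^D`:
`ker Γ(c) = ker Γ(ι_{H^⊥})` (§1).  In HEART-FROB's words: the annihilator of the flat closure `H` of `H_K` IS the flat closure of the annihilator `(H_K)^⊥`.
[cite: Tate1997FiniteFlatGroupSchemes, (3.7)] [cite: EGAIV2, Prop. 2.8.5] -/
theorem ker_comap_eq_ker_comap_annihilatorι_of_flat [Module.Flat R (Alg (annihilator j))]
    (h : RingHom.ker (Alg.comap ((Over.pullback (Spec.map (CommRingCat.ofHom (algebraMap R K)))).map c)).toRingHom =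
      RingHom.ker (Alg.comap ((Over.pullback (Spec.map (CommRingCat.ofHom (algebraMap R K)))).map (annihilatorι j))).toRingHom) :
    (RingHom.ker (Alg.comap c).toRingHom : Ideal (Alg (cartierDual G))) = RingHom.ker (Alg.comap (annihilatorι j)).toRingHom :=
  haveI := isClosedImmersion_annihilatorι_left j
  ker_comap_eq_of_flat_of_ker_comap_pullback_map_eq K c (annihilatorι j) h

variable [IsDomain R] [IsLocalRing R]

/-- **ANNIHILATORS COMMUTE WITH FLAT CLOSURE OVER A LOCAL DOMAIN** (a valuation ring `𝒪_Ω`, `𝒪_{F,w}`): as above, with `Γ(H^⊥)` free by ★ `free_alg_annihilator`.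
[cite: Tate1997FiniteFlatGroupSchemes, (3.7)] [cite: EGAIV2, Prop. 2.8.5] -/
theorem ker_comap_eq_ker_comap_annihilatorι_of_isLocalRing
    (h : RingHom.ker (Alg.comap ((Over.pullback (Spec.map (CommRingCat.ofHom (algebraMap R K)))).map c)).toRingHom =
      RingHom.ker (Alg.comap ((Over.pullback (Spec.map (CommRingCat.ofHom (algebraMap R K)))).map (annihilatorι j))).toRingHom) :
    (RingHom.ker (Alg.comap c).toRingHom : Ideal (Alg (cartierDual G))) = RingHom.ker (Alg.comap (annihilatorι j)).toRingHom := by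
  haveI := free_alg_annihilator K j
  exact ker_comap_eq_ker_comap_annihilatorι_of_flat K j c h

end Head

end AffineGroupScheme

end Literature.AlgebraicGeometry.GroupSchemes

end
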